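import Summits.Parity.GeneralizedHardyLittlewood.Theorems.LeeYangFibresAbsoluteUpgradeModGammaInvariantValueAux
import Summits.Parity.GeneralizedHardyLittlewood.Theorems.LeeYangFibresAbsoluteUpgradeModGammaAdjointEq
import Literature.Analysis.Complex.HolomorphicParametricIntegral
import HarnessLib

/-!
# Route `LeeYangFibres`, crux `AbsoluteUpgrade` (stmt-Parity-14116), line
# `dip-margin-rate-exchange`: the adjoint method for `ModGammaDisc` — the invariant's value
# `1/Γ(1+z)` on the disc (stub `mg_invariantValue`)

This file closes the registered stub `mg_invariantValue : MGEin → MGAdjointEq → MGInvariantValue`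
of the line's vocabulary `LeeYangFibresAbsoluteUpgradeModGammaDefs.lean`: for `N ≥ 1` and
`|z| ≤ N - 1`, `g̃_z(1) + z ∫_0^1 g̃_z(t+1) dt = 1/Γ(1+z)` (`g̃_z = adjTilde N z`), by ANALYTIC
CONTINUATION in `z` of the half-plane case `mg_invariantValue_halfplane` (`Re z > -1`, file
`…ModGammaInvariantValueAux.lean`):

* `InvVal.exists_bound_adjTilde` — a uniform bound `‖adjTilde N z v‖ ≤ M` for `‖z‖ < N - 1/2`,
  `1 ≤ v ≤ 2` (coefficient bound `‖p_k(z)‖ ≤ e^{Ne}2^k`, `|(z+1)⋯(z+k)| ≤ (2N+1)^N`,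
  `|v^{-(z+k+1)}| ≤ 2^N`, `1/Γ(1+z)` bounded on the closed ball, and the kernel majorant
  `AdjEq.norm_cpow_mul_remZ_le` under `e^{-x}`);
* `InvVal.differentiableOn_intervalIntegral_adjTilde` — `z ↦ ∫_0^1 adjTilde N z (t+1) dt` is
  holomorphic on the ball `‖z‖ < N - 1/2` (dominated holomorphic parametric integral, tree
  `Literature.Analysis.Complex.differentiableOn_integral_of_dominated`; the integrand is holomorphic
  in `z` by `AdjEq.differentiableOn_adjTilde` and continuous in `t` by
  `AdjEq.hasDerivAt_mul_adjTilde_explicit`);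
* `mg_invariantValue` — both sides are holomorphic on the (convex) ball
  `‖z‖ < N - 1/2 ⊇ {|z| ≤ N-1}` and agree on the open set `{‖z‖ < N - 1, Re z > -1} ∋ 0`
  (non-empty once some `|z| ≤ N - 1` has `Re z ≤ -1`), hence on the ball
  (`AnalyticOnNhd.eqOn_of_preconnected_of_eventuallyEq`).

References: G. Greaves, *Sieves in Number Theory* (2001), §4.2.3–§4.2.4 [Greaves2001]; de Bruijn
(1950), Alladi (1982), Tenenbaum III.6 for the Buchstab–Dickman context of `ModGammaDisc`.
-/

noncomputable section

namespace Summit.Parity.GeneralizedHardyLittlewood.Cruxes.AbsoluteUpgrade.DipMarginRateExchange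

open scoped BigOperators
open MeasureTheory Set Filter Topology
open Literature.NumberTheory.Sieve (ein einKernel expIntegralE1)

namespace InvVal

/-! ## Step 3: analyticity in `z` of the invariant on the ball `‖z‖ < N - 1/2` -/

/-- `adjTilde N z` is continuous on `(0, ∞)` for `Re z ≥ -N + 1/2` (from the explicit derivative of
`w ↦ w · adjTilde N z w`). -/
theorem continuousOn_adjTilde (hE : MGEin) (N : ℕ) {z : ℂ} (hz : -(N : ℝ) + 1 / 2 ≤ z.re) :
    ContinuousOn (adjTilde N z) (Ioi 0) :=
  continuousOn_of_hasDerivAt_mul fun _ hv => AdjEq.hasDerivAt_mul_adjTilde_explicit hE N hz hv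

/-- **Uniform bound for the regularised adjoint**: `‖adjTilde N z v‖ ≤ M` for `‖z‖ < N - 1/2` and `1
≤ v ≤ 2` (coefficient bound `‖p_k(z)‖ ≤ e^{Ne}2^k`, `|(z+1)⋯(z+k)| ≤ (2N+1)^N`, `|v^{-(z+k+1)}| ≤
2^N`, `1/Γ(1+z)` bounded on the closed ball, and the kernel majorant under `e^{-x}`). -/
theorem exists_bound_adjTilde (hE : MGEin) (N : ℕ) :
    ∃ M : ℝ, ∀ z : ℂ, ‖z‖ < (N : ℝ) - 1 / 2 → ∀ v : ℝ, 1 ≤ v → v ≤ 2 → ‖adjTilde N z v‖ ≤ M := by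
  obtain ⟨C, hC0, hC⟩ := AdjEq.norm_cpow_mul_remZ_le hE N (Λ := (N:ℝ)) (σ := -(N:ℝ) + 1 / 2)
    (Nat.cast_nonneg N) (by linarith)
  obtain ⟨MΓ, hMΓ⟩ := (isCompact_closedBall (0:ℂ) N).exists_bound_of_continuousOn
    (AdjEq.differentiable_Gamma_inv_one_add.continuous.continuousOn)
  have hJint : IntegrableOn (fun x : ℝ => C * (x ^ (-(N:ℝ) + 1 / 2 + N) * Real.exp (-(1 * x)) +
      x ^ (2 * (N:ℝ) + 2 * N) * Real.exp (-(1 * x)))) (Ioi 0) :=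
    ((AdjEq.integrableOn_rpow_mul_exp_neg_mul (by linarith) one_pos).add
      (AdjEq.integrableOn_rpow_mul_exp_neg_mul
        (by have := (Nat.cast_nonneg N : (0:ℝ) ≤ N); linarith) one_pos)).const_mul C
  set J : ℝ := ∫ x in Ioi (0:ℝ), C * (x ^ (-(N:ℝ) + 1 / 2 + N) * Real.exp (-(1 * x)) +
      x ^ (2 * (N:ℝ) + 2 * N) * Real.exp (-(1 * x))) with hJ
  set T : ℝ := Real.exp ((N:ℝ) * Real.exp 1) * 2 ^ N * (2 * (N:ℝ) + 1) ^ N * (2:ℝ) ^ (N:ℝ)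
    with hT
  have hγ0 : 0 ≤ Real.eulerMascheroniConstant :=
    (lt_trans one_half_pos Real.one_half_lt_eulerMascheroniConstant).le
  refine ⟨Real.exp (Real.eulerMascheroniConstant * N) * (N * T + MΓ * J), fun z hz v hv1 hv2 => ?_⟩
  have hzN : ‖z‖ ≤ N := by linarith
  have hzre : -(N:ℝ) + 1 / 2 ≤ z.re := by
    have := Complex.abs_re_le_norm z; have := neg_abs_le z.re; linarith
  have hv0 : 0 < v := by linarith
  rw [adjTilde, norm_mul]
  have he : ‖Complex.exp ((Real.eulerMascheroniConstant : ℂ) * z)‖ ≤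
      Real.exp (Real.eulerMascheroniConstant * N) := by
    rw [Complex.norm_exp, Real.exp_le_exp]
    simp only [Complex.mul_re, Complex.ofReal_re, Complex.ofReal_im, zero_mul, sub_zero]
    exact mul_le_mul_of_nonneg_left ((Complex.re_le_norm z).trans hzN) hγ0
  refine mul_le_mul he ((norm_add_le _ _).trans (add_le_add ?_ ?_)) (norm_nonneg _)
    (Real.exp_pos _).le
  · -- the power sum
    refine (norm_sum_le _ _).trans ?_
    have hterm : ∀ k ∈ Finset.range N, ‖pCoeff z k * (∏ i ∈ Finset.range k, (z + ((i : ℂ) + 1))) *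
        (v : ℂ) ^ (-(z + ((k : ℂ) + 1)))‖ ≤ T := by
      intro k hk
      have hkN : k < N := Finset.mem_range.mp hk
      rw [norm_mul, norm_mul]
      have h1 : ‖pCoeff z k‖ ≤ Real.exp ((N:ℝ) * Real.exp 1) * 2 ^ N := by
        calc ‖pCoeff z k‖ ≤ Real.exp (‖z‖ * Real.exp 1) * 2 ^ k := AdjEq.norm_pCoeff_le hE z k
          _ ≤ Real.exp ((N:ℝ) * Real.exp 1) * 2 ^ N := by
              refine mul_le_mul ?_ (pow_le_pow_right₀ (by norm_num) hkN.le) (by positivity)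
                (Real.exp_pos _).le
              exact Real.exp_le_exp.mpr (mul_le_mul_of_nonneg_right hzN (Real.exp_pos 1).le)
      have h2 : ‖∏ i ∈ Finset.range k, (z + ((i : ℂ) + 1))‖ ≤ (2 * (N:ℝ) + 1) ^ N := by
        calc ‖∏ i ∈ Finset.range k, (z + ((i : ℂ) + 1))‖
            = ∏ i ∈ Finset.range k, ‖z + ((i : ℂ) + 1)‖ := norm_prod _ _
          _ ≤ (2 * (N:ℝ) + 1) ^ k := by
              refine (Finset.prod_le_prod (fun i _ => norm_nonneg _) fun i hi => ?_).trans_eq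
                (by rw [Finset.prod_const, Finset.card_range])
              have hik : i < k := Finset.mem_range.mp hi
              have hi1 : (i:ℝ) + 1 ≤ N := by exact_mod_cast (by omega : i + 1 ≤ N)
              calc ‖z + ((i:ℂ) + 1)‖ ≤ ‖z‖ + ‖((i:ℂ) + 1)‖ := norm_add_le _ _
                _ = ‖z‖ + ((i:ℝ) + 1) := by
                    congr 1
                    rw [show ((i:ℂ) + 1) = (((i:ℝ) + 1 : ℝ) : ℂ) by push_cast; ring,
                      Complex.norm_real, Real.norm_of_nonneg (by positivity)]
                _ ≤ 2 * N + 1 := by linarith [norm_nonneg z]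
          _ ≤ (2 * (N:ℝ) + 1) ^ N := pow_le_pow_right₀ (by linarith) hkN.le
      have h3 : ‖(v : ℂ) ^ (-(z + ((k : ℂ) + 1)))‖ ≤ (2:ℝ) ^ (N:ℝ) := by
        rw [Complex.norm_cpow_eq_rpow_re_of_pos hv0]
        have hre : (-(z + ((k : ℂ) + 1))).re ≤ N := by
          simp only [Complex.neg_re, Complex.add_re, Complex.natCast_re, Complex.one_re]
          have := (Nat.cast_nonneg k : (0:ℝ) ≤ k)
          have := Complex.abs_re_le_norm z
          have := neg_abs_le z.re
          linarith
        calc v ^ (-(z + ((k : ℂ) + 1))).re ≤ v ^ (N:ℝ) := Real.rpow_le_rpow_of_exponent_le hv1 hre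
          _ ≤ 2 ^ (N:ℝ) := Real.rpow_le_rpow hv0.le hv2 (Nat.cast_nonneg N)
      calc ‖pCoeff z k‖ * ‖∏ i ∈ Finset.range k, (z + ((i : ℂ) + 1))‖ *
            ‖(v : ℂ) ^ (-(z + ((k : ℂ) + 1)))‖
          ≤ (Real.exp ((N:ℝ) * Real.exp 1) * 2 ^ N) * (2 * (N:ℝ) + 1) ^ N * (2:ℝ) ^ (N:ℝ) := by
            gcongr
        _ = T := by rw [hT]
    calc ∑ k ∈ Finset.range N, ‖pCoeff z k * (∏ i ∈ Finset.range k, (z + ((i : ℂ) + 1))) *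
          (v : ℂ) ^ (-(z + ((k : ℂ) + 1)))‖
        ≤ ∑ k ∈ Finset.range N, T := Finset.sum_le_sum hterm
      _ = N * T := by rw [Finset.sum_const, Finset.card_range, nsmul_eq_mul]
  · -- the Gamma factor times the remainder integral
    rw [norm_mul]
    have hΓ : ‖(Complex.Gamma (1 + z))⁻¹‖ ≤ MΓ := hMΓ z (mem_closedBall_zero_iff.mpr hzN)
    have hI : ‖∫ x in Ioi (0 : ℝ), Complex.exp (-((v : ℂ) * x)) * ((x : ℂ) ^ (z + (N : ℂ))) *
        remZ N z x‖ ≤ J := by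
      refine norm_integral_le_of_norm_le hJint ?_
      refine (ae_restrict_mem measurableSet_Ioi).mono fun x (hx : 0 < x) => ?_
      rw [mul_assoc, norm_mul, AdjEq.norm_cexp_neg_ofReal_mul]
      have hK := hC z hzN hzre x hx
      have hex : Real.exp (-(v * x)) ≤ Real.exp (-(1 * x)) := by
        rw [Real.exp_le_exp]; nlinarith
      calc Real.exp (-(v * x)) * ‖(x : ℂ) ^ (z + (N : ℂ)) * remZ N z x‖
          ≤ Real.exp (-(1 * x)) * (C * (x ^ (-(N:ℝ) + 1 / 2 + N) + x ^ (2 * (N:ℝ) + 2 * N))) :=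
            mul_le_mul hex hK (norm_nonneg _) (Real.exp_pos _).le
        _ = C * (x ^ (-(N:ℝ) + 1 / 2 + N) * Real.exp (-(1 * x)) +
              x ^ (2 * (N:ℝ) + 2 * N) * Real.exp (-(1 * x))) := by ring
    exact mul_le_mul hΓ hI (norm_nonneg _) ((norm_nonneg _).trans hΓ)

/-- The ball `‖z‖ < N - 1/2` lies in the half-plane `Re z > -N + 1/2`. -/
theorem ball_subset_halfPlane (N : ℕ) :
    Metric.ball (0:ℂ) ((N:ℝ) - 1 / 2) ⊆ {z : ℂ | -(N : ℝ) + 1 / 2 < z.re} := by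
  intro z hz
  rw [Metric.mem_ball, dist_zero_right] at hz
  have := Complex.abs_re_le_norm z
  have := neg_abs_le z.re
  show -(N : ℝ) + 1 / 2 < z.re
  linarith

/-- **(b)** `z ↦ ∫_0^1 adjTilde N z (t+1) dt` is holomorphic on the ball `‖z‖ < N - 1/2` (dominated
holomorphic parametric integral, tree
`Literature.Analysis.Complex.differentiableOn_integral_of_dominated`, with the constant majorant of
`exists_bound_adjTilde`). -/
theorem differentiableOn_intervalIntegral_adjTilde (hE : MGEin) (N : ℕ) :
    DifferentiableOn ℂ (fun z : ℂ => ∫ t in (0:ℝ)..1, adjTilde N z (t + 1))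
      (Metric.ball (0:ℂ) ((N:ℝ) - 1 / 2)) := by
  obtain ⟨M, hM⟩ := exists_bound_adjTilde hE N
  have hUre := ball_subset_halfPlane N
  simp only [intervalIntegral.integral_of_le zero_le_one]
  refine Literature.Analysis.Complex.differentiableOn_integral_of_dominated
    (μ := volume.restrict (Ioc (0:ℝ) 1)) (F := fun z t => adjTilde N z (t + 1)) ?_ ?_ ?_
  · intro z hz
    refine ContinuousOn.aestronglyMeasurable ?_ measurableSet_Ioc
    refine (continuousOn_adjTilde hE N (le_of_lt (hUre hz))).comp
      (continuous_id.add continuous_const).continuousOn fun t ht => ?_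
    show 0 < t + 1
    linarith [ht.1]
  · refine (ae_restrict_mem measurableSet_Ioc).mono fun t ht => ?_
    have ht1 : 0 < t + 1 := by linarith [ht.1]
    exact (AdjEq.differentiableOn_adjTilde hE N ht1).mono hUre
  · intro z₀ hz₀
    obtain ⟨R, hR, hRU⟩ := Metric.isOpen_iff.mp Metric.isOpen_ball z₀ hz₀
    refine ⟨R, hR, hRU, fun _ => M, integrable_const M, ?_⟩
    refine (ae_restrict_mem measurableSet_Ioc).mono fun t ht z hz => ?_
    exact hM z (mem_ball_zero_iff.mp (hRU hz)) (t + 1) (by linarith [ht.1]) (by linarith [ht.2])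

/-- **(a)+(b)** (with (a) = `AdjEq.differentiableOn_adjTilde`) The invariant `z ↦ adjTilde N z 1 + z
∫_0^1 adjTilde N z (t+1) dt` is holomorphic on the ball `‖z‖ < N - 1/2`. -/
theorem differentiableOn_invariant (hE : MGEin) (N : ℕ) :
    DifferentiableOn ℂ (fun z : ℂ => adjTilde N z 1 + z * ∫ t in (0:ℝ)..1, adjTilde N z (t + 1))
      (Metric.ball (0:ℂ) ((N:ℝ) - 1 / 2)) :=
  ((AdjEq.differentiableOn_adjTilde hE N one_pos).mono (ball_subset_halfPlane N)).add
    (differentiableOn_id.mul (differentiableOn_intervalIntegral_adjTilde hE N))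

end InvVal

/-- **Analyticity of the invariant in `z`** (registered helper for the stub `mg_invariantValue`,
line `dip-margin-rate-exchange`): for every `N`, `z ↦ g̃_z(1) + z ∫_0^1 g̃_z(t+1) dt` is holomorphic
on the ball `‖z‖ < N - 1/2` (every ingredient of `adjTilde` is holomorphic in `z` on `Re z > -N +
1/2`, and the `t`-integral is a dominated holomorphic parametric integral). -/
theorem mg_invariantValue_analytic (hE : MGEin) (N : ℕ) :
    DifferentiableOn ℂ (fun z : ℂ => adjTilde N z 1 + z * ∫ t in (0 : ℝ)..1, adjTilde N z (t + 1))
      (Metric.ball (0 : ℂ) ((N : ℝ) - 1 / 2)) :=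
  InvVal.differentiableOn_invariant hE N

/-- **The invariant's value** (registered stub `mg_invariantValue` of line
`dip-margin-rate-exchange`, crux stmt-Parity-14116; the initial-value theorem of the adjoint
method): for `N ≥ 1` and `|z| ≤ N - 1`, `g̃_z(1) + z ∫_0^1 g̃_z(t+1) dt = 1/Γ(1+z)`. For `Re z > -1`
this is `mg_invariantValue_halfplane` (both sides equal `lim_{t→0⁺} t g̃_z(t)`); in general both
sides are holomorphic on the ball `‖z‖ < N - 1/2` (`mg_invariantValue_analytic`, `1/Γ` entire) and
agree on the open set `{‖z‖ < N - 1, Re z > -1} ∋ 0`, so they agree on the ball (identity theorem).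
-/
theorem mg_invariantValue : MGEin → MGAdjointEq → MGInvariantValue := by
  intro hE hEq N hN z hz
  by_cases hre : -1 < z.re
  · exact mg_invariantValue_halfplane hE hEq N hN z hz hre
  · have hre' : z.re ≤ -1 := not_lt.mp hre
    have hN1 : (1:ℝ) ≤ (N:ℝ) - 1 := by
      have h1 : |z.re| ≤ ‖z‖ := Complex.abs_re_le_norm z
      have h2 : 1 ≤ |z.re| := by rw [abs_of_neg (by linarith)]; linarith
      linarith
    set U : Set ℂ := Metric.ball (0:ℂ) ((N:ℝ) - 1 / 2) with hU
    have hUo : IsOpen U := Metric.isOpen_ball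
    have hUc : IsPreconnected U := (convex_ball (0:ℂ) _).isPreconnected
    have h0U : (0:ℂ) ∈ U := Metric.mem_ball_self (by linarith)
    have hzU : z ∈ U := by
      rw [hU, Metric.mem_ball, dist_zero_right]
      linarith
    have hF := (mg_invariantValue_analytic hE N).analyticOnNhd hUo
    have hG : AnalyticOnNhd ℂ (fun w : ℂ => (Complex.Gamma (1 + w))⁻¹) U :=
      AdjEq.differentiable_Gamma_inv_one_add.differentiableOn.analyticOnNhd hUo
    refine hF.eqOn_of_preconnected_of_eventuallyEq hG hUc h0U ?_ hzU
    have hnhds : Metric.ball (0:ℂ) ((N:ℝ) - 1) ∩ {w : ℂ | -1 < w.re} ∈ 𝓝 (0:ℂ) :=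
      inter_mem (Metric.ball_mem_nhds 0 (by linarith))
        ((isOpen_lt continuous_const Complex.continuous_re).mem_nhds (by simp))
    filter_upwards [hnhds] with w hw
    have hw1 := hw.1
    rw [Metric.mem_ball, dist_zero_right] at hw1
    exact mg_invariantValue_halfplane hE hEq N hN w hw1.le hw.2

end Summit.Parity.GeneralizedHardyLittlewood.Cruxes.AbsoluteUpgrade.DipMarginRateExchange

end
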